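import Summits.CriticalPhenomena.PercolationContinuityZ3.Theorems.PercNearOneGluingNoHeavyLowerTailCILOwnEdgeStability
import Summits.CriticalPhenomena.PercolationContinuityZ3.Theorems.PercNearOneGluingNoHeavyLowerTailCILPortDomination
import Summits.CriticalPhenomena.PercolationContinuityZ3.Theorems.PercNearOneGluingAdditiveGluingEdgeSwitch
import HarnessLib

/-!
# `NoHeavyLowerTail` (stmt-CriticalPhenomena-4575) — tools for the scaled-reference theorem: affinity in one pair,
# raising a pair at the loser of a lightness comparison, pairs of weight one, corner domination

Support file (prover `prim-hp-3`, hull-port line; `--supports stmt-CriticalPhenomena-4575`).  No definitions, no named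
facts, no sorries.  Notation: `μ_w = prodBernoulli w` on `Fin n`, relays `A`, level `j`, `π(x) = {z ∈ A : x ↔ z}`,
`I_w(x) = μ_w{|π(x)| ≤ j}` (lightness), `bad_w(o) = μ_w{1 ≤ |π(o)| ≤ j}`.

* `HullPort.real_update_affine` — `μ_{w[e↦u]}(S) = (1−u) μ_{w[e↦0]}(S) + u μ_{w[e↦1]}(S)` (one-bond decomposition
  `stub_oneBondDecomp_k15` at an arbitrary value of the coordinate); `affine_nonpos_of_le`, `affine_nonneg_of_le` — the
  real arithmetic of affine functions on `[t, 1]`.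
* `HullPort.lightness_le_of_raise_own_edge` — if `I(c) ≤ I(x)` when the pair `s(c,v)` has weight `t`, then also when it has
  any weight `s ≥ t`: RAISING A PAIR AT THE LOSER of a lightness comparison preserves the comparison (affinity + the glued
  comparison `CutObserver.lightness_glued_le`, van den Berg–Häggström–Kahn Thm 1.5).  The weight-`0` starting point is the
  tree's own-edge stability; the arbitrary starting weight is what the scaled-reference theorem needs.
* `HullPort.lightness_eq_of_weight_one`, `bad_eq_lightness_of_weight_one` — a pair of weight `1` is a.s. open
  (`Theorems.edgeSw_real_eq_of_sure`): `I(o) = I(p)` and `bad(o) = I(p)` when `w s(o,p) = 1`, `p ∈ A`.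
* `HullPort.corner_domination` — for a finite set `S` of pairs at `o` containing `s(o,p)`, `I_w(p) ≤ I_w(q)` implies the
  same comparison after raising all pairs of `S` to weight `1` (first `s(o,p)`, a pair at `p`; then the others, pairs at `o`,
  which is then glued to `p`).
The theorem itself (`HullPort.valid_of_valid_dominating_below`, `HullPort.cil_of_portDomination_scaled`) is in
`…CILScaledReference.lean`.
-/

noncomputable section

namespace Summit.CriticalPhenomena.PercolationContinuityZ3.Theorems

open MeasureTheory Set Literature.Probability.LatticeModels Literature.Probability.Percolation
open scoped Classical BigOperators

variable {n : ℕ}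

namespace HullPort

/-! ### Affinity in one coordinate -/

/-- One-bond decomposition at an arbitrary value of the coordinate: for every event `S`,
`μ_{w[e ↦ u]}(S) = (1 − u)·μ_{w[e ↦ 0]}(S) + u·μ_{w[e ↦ 1]}(S)`. [folklore] -/
theorem real_update_affine (w : Sym2 (Fin n) → unitInterval) (e : Sym2 (Fin n)) (u : unitInterval)
    (S : Set (BondConfig (Fin n))) :
    (prodBernoulli (Function.update w e u)).real S =
      (1 - (u : ℝ)) * (prodBernoulli (Function.update w e 0)).real S +
        (u : ℝ) * (prodBernoulli (Function.update w e 1)).real S := by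
  have h := stub_oneBondDecomp_k15 n (Function.update w e u) e S
  simp only [Function.update_self, Function.update_idem] at h
  exact h

/-- Real arithmetic: an affine function `f(u) = (1−u) f₀ + u f₁` on `[0,1]` with `f(t) ≤ 0` and `f(1) = f₁ ≤ 0` is
`≤ 0` on `[t, 1]`. [folklore] -/
theorem affine_nonpos_of_le {f₀ f₁ t s : ℝ} (hts : t ≤ s) (hs : s ≤ 1)
    (hft : (1 - t) * f₀ + t * f₁ ≤ 0) (hf₁ : f₁ ≤ 0) : (1 - s) * f₀ + s * f₁ ≤ 0 := by
  by_cases h : f₁ ≤ f₀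
  · have h1 : (s - t) * (f₁ - f₀) ≤ 0 := mul_nonpos_of_nonneg_of_nonpos (by linarith) (by linarith)
    nlinarith
  · push Not at h
    have h1 : (1 - s) * f₀ ≤ (1 - s) * f₁ := mul_le_mul_of_nonneg_left h.le (by linarith)
    linarith

/-- Real arithmetic: an affine function `d(u) = (1−u) d₀ + u d₁` on `[0,1]` with `d(t) ≥ 0` and `d₀ ≥ 0 → d₁ ≥ 0` is
`≥ 0` on `[t, 1]`. [folklore] -/
theorem affine_nonneg_of_le {d₀ d₁ t s : ℝ} (ht : 0 ≤ t) (hts : t ≤ s) (hs : s ≤ 1)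
    (hdt : 0 ≤ (1 - t) * d₀ + t * d₁) (hglue : 0 ≤ d₀ → 0 ≤ d₁) : 0 ≤ (1 - s) * d₀ + s * d₁ := by
  by_cases h : 0 ≤ d₀
  · have h1 := hglue h
    have h2 : 0 ≤ (1 - s) * d₀ := mul_nonneg (by linarith) h
    have h3 : 0 ≤ s * d₁ := mul_nonneg (by linarith) h1
    linarith
  · push Not at h
    have h1 : -d₀ ≤ t * (d₁ - d₀) := by linarith
    have h2 : 0 < d₁ - d₀ := by
      by_contra hc
      push Not at hc
      have : t * (d₁ - d₀) ≤ 0 := mul_nonpos_of_nonneg_of_nonpos ht hc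
      linarith
    have h3 : t * (d₁ - d₀) ≤ s * (d₁ - d₀) := mul_le_mul_of_nonneg_right hts h2.le
    linarith

/-! ### Raising a pair at the loser of a lightness comparison -/

/-- **Raising an own pair of the loser preserves a lightness comparison.**  Let `c ≠ v`, `x ≠ c`, `e = s(c,v)` and
`t ≤ s` in `[0,1]`.  If `I_{w[e↦t]}(c) ≤ I_{w[e↦t]}(x)` then `I_{w[e↦s]}(c) ≤ I_{w[e↦s]}(x)`.  (Affinity in the weight of
`e` and the glued comparison `CutObserver.lightness_glued_le` at the endpoint `1`.)
[cite: VandenbergHaggstromKahn2005, Thm. 1.5 (p. 7) — corollary] -/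
theorem lightness_le_of_raise_own_edge (w : Sym2 (Fin n) → unitInterval) (A : Finset (Fin n)) (c v x : Fin n)
    (j : ℕ) (hcv : c ≠ v) (hxc : x ≠ c) (t s : unitInterval) (hts : (t : ℝ) ≤ (s : ℝ))
    (hle : (prodBernoulli (Function.update w s(c, v) t)).real
          {ω : BondConfig (Fin n) | (A.filter fun z => ω ∈ openConn c z).card ≤ j} ≤
        (prodBernoulli (Function.update w s(c, v) t)).real
          {ω : BondConfig (Fin n) | (A.filter fun z => ω ∈ openConn x z).card ≤ j}) :
    (prodBernoulli (Function.update w s(c, v) s)).real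
          {ω : BondConfig (Fin n) | (A.filter fun z => ω ∈ openConn c z).card ≤ j} ≤
        (prodBernoulli (Function.update w s(c, v) s)).real
          {ω : BondConfig (Fin n) | (A.filter fun z => ω ∈ openConn x z).card ≤ j} := by
  set e : Sym2 (Fin n) := s(c, v) with he
  set Rc := {ω : BondConfig (Fin n) | (A.filter fun z => ω ∈ openConn c z).card ≤ j} with hRc
  set Rx := {ω : BondConfig (Fin n) | (A.filter fun z => ω ∈ openConn x z).card ≤ j} with hRx
  set w₀ := Function.update w e 0 with hw₀
  have hw₀e : w₀ s(c, v) = 0 := by simp [hw₀, he]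
  have hw₁ : Function.update w e 1 = Function.update w₀ s(c, v) 1 := by
    rw [hw₀, he, Function.update_idem]
  have hglue : (prodBernoulli w₀).real Rc ≤ (prodBernoulli w₀).real Rx →
      (prodBernoulli (Function.update w e 1)).real Rc ≤ (prodBernoulli (Function.update w e 1)).real Rx := by
    intro h0
    rw [hw₁]
    exact CutObserver.lightness_glued_le w₀ A c v x j hcv hxc hw₀e h0
  have ht_c := real_update_affine w e t Rc
  have ht_x := real_update_affine w e t Rx
  have hs_c := real_update_affine w e s Rc
  have hs_x := real_update_affine w e s Rx
  rw [← hw₀] at ht_c ht_x hs_c hs_x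
  have key := affine_nonneg_of_le (d₀ := (prodBernoulli w₀).real Rx - (prodBernoulli w₀).real Rc)
    (d₁ := (prodBernoulli (Function.update w e 1)).real Rx - (prodBernoulli (Function.update w e 1)).real Rc)
    (t := (t : ℝ)) (s := (s : ℝ)) t.2.1 hts s.2.2 (by rw [ht_c, ht_x] at hle; linarith)
    (fun h0 => by have := hglue (by linarith); linarith)
  rw [hs_c, hs_x]
  linarith

/-! ### Pairs of weight one -/

/-- On a configuration containing the pair `s(o,p)` (`o ≠ p`), the relay sets of `o` and `p` coincide. [folklore] -/
theorem filter_openConn_eq_of_mem (A : Finset (Fin n)) {o p : Fin n} (hop : o ≠ p) {ω : BondConfig (Fin n)}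
    (he : s(o, p) ∈ ω) :
    (A.filter fun z => ω ∈ openConn o z) = (A.filter fun z => ω ∈ openConn p z) := by
  have hadj : (openGraph ω).Adj o p := (openGraph_adj ω o p).mpr ⟨he, hop⟩
  have hop' : (openGraph ω).Reachable o p := hadj.reachable
  apply Finset.filter_congr
  intro z _
  change (openGraph ω).Reachable o z ↔ (openGraph ω).Reachable p z
  exact ⟨fun h => hop'.symm.trans h, fun h => hop'.trans h⟩

/-- **Glued lightness.**  If `w s(o,p) = 1` then `I_w(o) = I_w(p)`. [folklore] -/
theorem lightness_eq_of_weight_one (w : Sym2 (Fin n) → unitInterval) (A : Finset (Fin n)) {o p : Fin n} (hop : o ≠ p)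
    (j : ℕ) (hw : w s(o, p) = 1) :
    (prodBernoulli w).real {ω : BondConfig (Fin n) | (A.filter fun z => ω ∈ openConn o z).card ≤ j} =
      (prodBernoulli w).real {ω : BondConfig (Fin n) | (A.filter fun z => ω ∈ openConn p z).card ≤ j} := by
  apply edgeSw_real_eq_of_sure w s(o, p) hw
  intro ω he
  simp only [mem_setOf_eq]
  rw [filter_openConn_eq_of_mem A hop he]

/-- **Glued observer.**  If `w s(o,p) = 1` with `p ∈ A` then `bad_w(o) = I_w(p)`: the observer's block is a.s. the
relay's block, which always holds the relay `p`. [folklore] -/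
theorem bad_eq_lightness_of_weight_one (w : Sym2 (Fin n) → unitInterval) (A : Finset (Fin n)) {o p : Fin n}
    (hop : o ≠ p) (hpA : p ∈ A) (j : ℕ) (hw : w s(o, p) = 1) :
    (prodBernoulli w).real {ω : BondConfig (Fin n) |
        1 ≤ (A.filter fun z => ω ∈ openConn o z).card ∧ (A.filter fun z => ω ∈ openConn o z).card ≤ j} =
      (prodBernoulli w).real {ω : BondConfig (Fin n) | (A.filter fun z => ω ∈ openConn p z).card ≤ j} := by
  apply edgeSw_real_eq_of_sure w s(o, p) hw
  intro ω he
  simp only [mem_setOf_eq]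
  rw [filter_openConn_eq_of_mem A hop he]
  constructor
  · exact fun h => h.2
  · intro h
    refine ⟨?_, h⟩
    apply Finset.one_le_card.mpr
    refine ⟨p, ?_⟩
    simp only [Finset.mem_filter]
    exact ⟨hpA, (SimpleGraph.Reachable.refl p : (openGraph ω).Reachable p p)⟩


/-! ### Corners: raising a set of pairs at the observer to weight one -/

/-- Raising one more pair: the corner weight of `insert e T` is the corner weight of `T` updated at `e`. [folklore] -/
theorem corner_insert (w : Sym2 (Fin n) → unitInterval) (T : Finset (Sym2 (Fin n))) (e : Sym2 (Fin n)) :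
    (fun e' => if e' ∈ insert e T then (1 : unitInterval) else w e') =
      Function.update (fun e' => if e' ∈ T then (1 : unitInterval) else w e') e 1 := by
  funext e'
  by_cases h : e' = e
  · subst h
    simp
  · rw [Function.update_of_ne h]
    simp [Finset.mem_insert, h]

/-- The empty corner is the weight function itself. [folklore] -/
theorem corner_empty (w : Sym2 (Fin n) → unitInterval) :
    (fun e' => if e' ∈ (∅ : Finset (Sym2 (Fin n))) then (1 : unitInterval) else w e') = w := by
  funext e'
  simp

/-- **Corner domination.**  Let `o, q, p` be distinct, `S` a finite set of pairs AT `o` containing `s(o,p)`, and `w^S`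
the weight function with the pairs of `S` raised to `1`.  If `I_w(p) ≤ I_w(q)` then `I_{w^S}(p) ≤ I_{w^S}(q)`: first raise
`s(o,p)` (a pair at the loser `p`), then the other pairs of `S` (pairs at `o`, which is then a.s. glued to `p`), each time by
`lightness_le_of_raise_own_edge`. [cite: VandenbergHaggstromKahn2005, Thm. 1.5 (p. 7) — corollary] -/
theorem corner_domination (w : Sym2 (Fin n) → unitInterval) (A : Finset (Fin n)) (o q p : Fin n) (j : ℕ)
    (hoq : o ≠ q) (hop : o ≠ p) (hqp : q ≠ p) (S : Finset (Sym2 (Fin n)))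
    (hS : ∀ e ∈ S, ∃ v, v ≠ o ∧ e = s(o, v)) (hpS : s(o, p) ∈ S)
    (hle : (prodBernoulli w).real {ω : BondConfig (Fin n) | (A.filter fun z => ω ∈ openConn p z).card ≤ j} ≤
      (prodBernoulli w).real {ω : BondConfig (Fin n) | (A.filter fun z => ω ∈ openConn q z).card ≤ j}) :
    (prodBernoulli (fun e' => if e' ∈ S then (1 : unitInterval) else w e')).real
        {ω : BondConfig (Fin n) | (A.filter fun z => ω ∈ openConn p z).card ≤ j} ≤
      (prodBernoulli (fun e' => if e' ∈ S then (1 : unitInterval) else w e')).real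
        {ω : BondConfig (Fin n) | (A.filter fun z => ω ∈ openConn q z).card ≤ j} := by
  set e₀ : Sym2 (Fin n) := s(o, p) with he₀
  set Rp := {ω : BondConfig (Fin n) | (A.filter fun z => ω ∈ openConn p z).card ≤ j} with hRp
  set Rq := {ω : BondConfig (Fin n) | (A.filter fun z => ω ∈ openConn q z).card ≤ j} with hRq
  set Ro := {ω : BondConfig (Fin n) | (A.filter fun z => ω ∈ openConn o z).card ≤ j} with hRo
  -- statement for `insert e₀ T`, by induction on `T ⊆ S.erase e₀`
  have main : ∀ T : Finset (Sym2 (Fin n)), T ⊆ S.erase e₀ →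
      (prodBernoulli (fun e' => if e' ∈ insert e₀ T then (1 : unitInterval) else w e')).real Rp ≤
        (prodBernoulli (fun e' => if e' ∈ insert e₀ T then (1 : unitInterval) else w e')).real Rq := by
    intro T
    induction T using Finset.induction_on with
    | empty =>
      intro _
      rw [corner_insert, corner_empty]
      -- raise `e₀ = s(p, o)` at the loser `p` from `w e₀` to `1`
      have h0 : Function.update w s(p, o) (w e₀) = w := by
        rw [Sym2.eq_swap, ← he₀]; exact Function.update_eq_self e₀ w
      have h := lightness_le_of_raise_own_edge w A p o q j (Ne.symm hop) hqp (w e₀) 1 (w e₀).2.2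
        (by rw [h0]; exact hle)
      rw [Sym2.eq_swap, ← he₀] at h
      exact h
    | insert e T heT ih =>
      intro hsub
      have hTsub : T ⊆ S.erase e₀ := fun x hx => hsub (Finset.mem_insert_of_mem hx)
      have heS : e ∈ S.erase e₀ := hsub (Finset.mem_insert_self e T)
      have he_ne : e ≠ e₀ := Finset.ne_of_mem_erase heS
      obtain ⟨v, hvo, hev⟩ := hS e (Finset.mem_of_mem_erase heS)
      have ih' := ih hTsub
      set w' : Sym2 (Fin n) → unitInterval := fun e' => if e' ∈ insert e₀ T then (1 : unitInterval) else w e'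
        with hw'
      -- in `w'` the pair `e₀` has weight one, so `I(o) = I(p)`
      have hw'e₀ : w' s(o, p) = 1 := by simp [hw', he₀]
      have hglued : (prodBernoulli w').real Ro = (prodBernoulli w').real Rp :=
        lightness_eq_of_weight_one w' A hop j hw'e₀
      have hoq' : (prodBernoulli w').real Ro ≤ (prodBernoulli w').real Rq := by rw [hglued]; exact ih'
      -- raise `e = s(o,v)` at `o` from `w' e` to `1`
      have h0 : Function.update w' s(o, v) (w' e) = w' := by
        rw [← hev]; exact Function.update_eq_self e w'
      have h := lightness_le_of_raise_own_edge w' A o v q j (Ne.symm hvo) (Ne.symm hoq) (w' e) 1 (w' e).2.2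
        (by rw [h0]; exact hoq')
      rw [← hev] at h
      -- rewrite the corner of `insert e₀ (insert e T)` as the update of `w'` at `e`
      have hcorner : (fun e' => if e' ∈ insert e₀ (insert e T) then (1 : unitInterval) else w e') =
          Function.update w' e 1 := by
        rw [Finset.insert_comm]
        exact corner_insert w (insert e₀ T) e
      rw [hcorner]
      -- transfer back from `o` to `p` in the raised weights (still `e₀ ↦ 1`)
      have hw''e₀ : Function.update w' e 1 s(o, p) = 1 := by
        rw [← he₀, Function.update_of_ne (Ne.symm he_ne)]
        exact hw'e₀
      have hglued' : (prodBernoulli (Function.update w' e 1)).real Ro =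
          (prodBernoulli (Function.update w' e 1)).real Rp :=
        lightness_eq_of_weight_one (Function.update w' e 1) A hop j hw''e₀
      rw [← hglued']
      exact h
  have hS' : S = insert e₀ (S.erase e₀) := (Finset.insert_erase hpS).symm
  rw [hS']
  exact main (S.erase e₀) subset_rfl

end HullPort

end Summit.CriticalPhenomena.PercolationContinuityZ3.Theorems

end
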